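import Summits.QuantumFields.YangMills.Theorems.PoincareLipschitzAxialStationarity
import Summits.QuantumFields.YangMills.Theorems.PoincareLipschitzSobolevChainRuleByApproximation
import Summits.QuantumFields.YangMills.Theorems.PoincareLipschitzLatticeToContinuumSobolevLetters
import Summits.QuantumFields.YangMills.Theorems.PoincareLipschitzSmoothNormalisation
import Summits.QuantumFields.YangMills.Theorems.PoincareLipschitzMinimiserStabilityLetters
import Literature.Analysis.FunctionSpaces.SobolevDomainProofs
import Literature.Analysis.FunctionSpaces.SobolevTraceDensityProofs
import HarnessLib

/-!
# Crux `BlockLipschitzL` (stmt-QuantumFields-23533) ∕ `HistoryTailL` (stmt-QuantumFields-19936), LINE 25 «CompactnessTransfer»,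
# K2 continuum face, row (RS) `MinimisingMapSmoothness` — FILE (RS-a)-1 «THE SECOND OUTER VARIATION OF A BALL MINIMISER,
# ONE DIRECTION AT A TIME»

Cell `ym3-torus` (YM ladder rung R3 = continuum SU(2) Yang–Mills on T³ — a RUNG, NOT the Clay problem: not d = 4, not infinite
volume, not a mass gap); WIDTH helper seat `ym-ust-19936-w7` g14 (LEAD ★w1-19936 g10 2026-08-29T14:39:36Z «(RS-a) at own risk,
helper class, limit-free»).  THEOREMS ONLY (0 `def`, 0 `sorry`, default heartbeats).  Imports: w2 g13 ✓FILE γ `…AxialStationarity`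
(letters), w2 ✓(CR) `…SobolevChainRule` (`hasWeakFDerivOn_comp_of_fderiv_bounded`), px3 ✓`…LatticeToContinuumSobolevLetters`
(`weakFDeriv_ae_eq_of_eqOn` — locality∕uniqueness of weak gradients), this seat's ✓`…SmoothNormalisation` (the smooth map
`N y = σ(16‖y‖² − 1)•y∕‖y‖` over px22's ray-projection calculus) and ✓`…MinimiserStabilityLetters` (the pure-ℝ expansion).

THE OBJECT.  `U` weakly differentiable on the open `Ω ⊆ ℝ³` with weak gradient `G`, UNIT on `Ω` (values in a real Hilbert space
`F`), of finite energy `∫_Ω dens G`, `dens G := Σᵢ ‖G eᵢ‖²`, minimising on the ball `B_ρ(y) ⊆ Ω` among finite-energy unit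
`W^{1,2}(Ω)` competitors agreeing with `U` off some `B_{ρ″}(y)`, `ρ″ < ρ` (w2's `hmin` row VERBATIM = the vended class of lit
`MinimisingMapSmoothness` ∕ `…Compactness`).

WHAT THIS FILE PROVES.
* §1 ★ `inner_weakGrad_eq_zero_ae` — TANGENCY: `⟪U x, G x eᵢ⟫ = 0` for a.e. `x ∈ Ω` (from the chain rule at `t = 0`: `N ∘ U = U` on
  `Ω` has weak gradient `DN(U) ∘ G = G − ⟪U, G·⟫U`, and weak gradients are a.e. unique — NO `L²` hypothesis on `U`).
* §2 ★★ `exists_normalised_competitor` — for a unit vector `e`, a test function `ζ` (`|ζ| ≤ 1`, `‖∇ζ‖ ≤ 1`) and `|t| ≤ ¼`, the map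
  `W_t = N(U + tζ e)` (suitably continued off `Ω`) is an admissible competitor whose energy density on `Ω` is, a.e., EXACTLY the
  rational function `Σᵢ (D·Hᵢ − Kᵢ²)∕D²` of the letters file (`D = ‖U + tζe‖² = 1 + 2tζ⟪U,e⟫ + t²ζ²`, …).
  (letters: `hasWeakFDerivOn_translate`, `integrableOn_dens_translate`, `integrableOn_dens_comp`, ★ `dens_normalised_pointwise`).
The one-direction inequality `0 ≤ t·∫Q₁(e) + t²·∫Q₂(e) + |t|³·S·∫(dens G + |∇ζ|²)`, its sum over an orthonormal basis and the
conclusion `(n − 3)∫ζ²·dens G ≤ (n − 1)∫|∇ζ|²` [SchoenUhlenbeck1984 (1.3)–(1.5)] are FILE (RS-a)-2 ✓`PoincareLipschitzMinimiserStability`.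
HONEST SCOPE.  Calculus of variations for Sobolev maps; nothing of (RS), (C), S1″, K1, `MeanDeviationL`, `BlockLipschitzL`,
`HistoryTailL` is proved here; YM₃ on T³ is rung R3, not Clay; YM gap NOT proved; no summit statement is proved here.

References: R. Schoen, K. Uhlenbeck, Invent. Math. 78 (1984) 89–100 [SchoenUhlenbeck1984] (§1); L. Simon, Theorems on Regularity
and Singularity of Energy Minimizing Maps (1996) [Simon1996] (§2.2); R. Hardt, D. Kinderlehrer, F.-H. Lin, Comm. Math. Phys. 105
(1986) [HardtKinderlehrerLin1986] (§2, the normalised variations).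
-/

set_option autoImplicit false

noncomputable section

open MeasureTheory Set Function Filter Topology Metric TopologicalSpace
open scoped ContDiff RealInnerProductSpace BigOperators

namespace Summit.QuantumFields.YangMills.Theorems.PoincareLipschitzMinimiserSecondVariation

open Literature.Analysis.FunctionSpaces (IsTestFunctionOn HasWeakFDerivOn)
open Literature.Analysis.FunctionSpaces.SobolevApprox (hasWeakFDerivOn_add)
open Summit.QuantumFields.YangMills.Theorems.PoincareLipschitzAxialStationarityLetters
open Summit.QuantumFields.YangMills.Theorems.PoincareLipschitzSobolevChainRule (hasWeakFDerivOn_comp_of_fderiv_bounded)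
open Summit.QuantumFields.YangMills.Theorems.PoincareLipschitzLatticeToContinuumSobolevLetters (weakFDeriv_ae_eq_of_eqOn)
open Summit.QuantumFields.YangMills.Theorems.PoincareLipschitzSmoothNormalisation
open Summit.QuantumFields.YangMills.Theorems.PoincareLipschitzMinimiserStabilityLetters

variable {F : Type*} [NormedAddCommGroup F] [InnerProductSpace ℝ F] [CompleteSpace F]

/-! ## §1 Tangency of the weak gradient of a unit map -/

/-- ★ **TANGENCY**: for a unit Sobolev map, `⟪U x, G x v⟫ = 0` for a.e. `x ∈ Ω` and every direction `v` — by the chain rule for the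
smooth normalisation `N` (`N ∘ U = U` on `Ω`, weak gradient `DN(U) ∘ G` with `DN(U)h = h − ⟪U,h⟫U`) and a.e. uniqueness of weak
gradients. [cite: Simon1996, §2.2] -/
theorem inner_weakGrad_eq_zero_ae {Ω : Opens (EuclideanSpace ℝ (Fin 3))}
    {U : EuclideanSpace ℝ (Fin 3) → F} {G : EuclideanSpace ℝ (Fin 3) → EuclideanSpace ℝ (Fin 3) →L[ℝ] F}
    (hU : HasWeakFDerivOn Ω volume U G) (hU1 : ∀ x ∈ (Ω : Set (EuclideanSpace ℝ (Fin 3))), ‖U x‖ = 1) :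
    ∀ᵐ x ∂(volume.restrict (Ω : Set (EuclideanSpace ℝ (Fin 3)))), ∀ v : EuclideanSpace ℝ (Fin 3), ⟪U x, G x v⟫ = 0 := by
  obtain ⟨C, hC⟩ := exists_norm_fderiv_smoothNormalize_le (V := F)
  have hN := hasWeakFDerivOn_comp_of_fderiv_bounded (μ := volume) hU (contDiff_smoothNormalize (V := F)) hC
  -- `N ∘ U = U` on `Ω`
  have hNU : ∀ x ∈ (Ω : Set (EuclideanSpace ℝ (Fin 3))),
      Real.smoothTransition (‖U x‖ ^ 2 / (1 / 4) ^ 2 - 1) • (‖U x‖⁻¹ • U x) = U x := by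
    intro x hx
    rw [smoothNormalize_eq (by rw [hU1 x hx]; norm_num), hU1 x hx, inv_one, one_smul]
  have hae := weakFDeriv_ae_eq_of_eqOn hU hN le_rfl hNU
  filter_upwards [hae, ae_restrict_mem Ω.isOpen.measurableSet] with x hx hxΩ v
  have h1 : 1 / 8 < ‖U x‖ ^ 2 := by rw [hU1 x hxΩ]; norm_num
  have h2 := congrArg (fun L : EuclideanSpace ℝ (Fin 3) →L[ℝ] F => L v) hx
  simp only [ContinuousLinearMap.comp_apply] at h2
  rw [fderiv_smoothNormalize_apply h1, hU1 x hxΩ, one_pow, inv_one, one_smul] at h2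
  -- `h2 : G x v + (-(1) * ⟪U x, G x v⟫) • U x = G x v`
  have h3 : ⟪U x, G x v⟫ • U x = 0 := by
    have : (-1 * ⟪U x, G x v⟫) • U x = 0 := by
      have h4 := h2
      rw [add_eq_left] at h4
      exact h4
    rw [neg_one_mul, neg_smul, neg_eq_zero] at this
    exact this
  have h5 : ⟪U x, G x v⟫ * ‖U x‖ ^ 2 = 0 := by
    have := congrArg (fun z => ⟪z, U x⟫) h3
    simp only [real_inner_smul_left, inner_zero_left, real_inner_self_eq_norm_sq] at this
    exact this
  rw [hU1 x hxΩ, one_pow, mul_one] at h5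
  exact h5

/-! ## §2 The normalised competitor `W_t = N(U + tζe)` -/

omit [CompleteSpace F] in
/-- **The translated map `Y = U + tζ•e` is Sobolev** with weak gradient `G + (t•∇ζ) ⊗ e`. [folklore] -/
theorem hasWeakFDerivOn_translate {Ω : Opens (EuclideanSpace ℝ (Fin 3))}
    {U : EuclideanSpace ℝ (Fin 3) → F} {G : EuclideanSpace ℝ (Fin 3) → EuclideanSpace ℝ (Fin 3) →L[ℝ] F}
    (hU : HasWeakFDerivOn Ω volume U G) (e : F) {ζ : EuclideanSpace ℝ (Fin 3) → ℝ} (hζ : ContDiff ℝ ∞ ζ) (t : ℝ) :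
    HasWeakFDerivOn Ω volume (fun x => U x + (t * ζ x) • e) (fun x => G x + (t • fderiv ℝ ζ x).smulRight e) := by
  have hζd : Differentiable ℝ ζ := hζ.differentiable (by simp)
  have hsm : ContDiff ℝ 1 (fun x : EuclideanSpace ℝ (Fin 3) => (t * ζ x) • e) :=
    ((contDiff_const.mul (hζ.of_le (by simp))).smul contDiff_const)
  have hY0 := hasWeakFDerivOn_add hU (Literature.Analysis.FunctionSpaces.HasWeakFDerivOn.of_contDiff_holds Ω volume hsm)
  have hfd : ∀ x, fderiv ℝ (fun x : EuclideanSpace ℝ (Fin 3) => (t * ζ x) • e) x = (t • fderiv ℝ ζ x).smulRight e := by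
    intro x
    have h1 : HasFDerivAt (fun x => t * ζ x) (t • fderiv ℝ ζ x) x := (hζd x).hasFDerivAt.const_mul t
    exact (h1.smul_const e).fderiv
  have e1 : (U + fun x => (t * ζ x) • e) = fun x => U x + (t * ζ x) • e := by funext x; simp
  have e2 : (G + fderiv ℝ fun x => (t * ζ x) • e) = fun x => G x + (t • fderiv ℝ ζ x).smulRight e := by
    funext x; simp [hfd x]
  rw [e1, e2] at hY0
  exact hY0

omit [CompleteSpace F] in
/-- **The translated gradient has integrable density on `Ω`** (`|t| ≤ 1`, `‖∇ζ‖` continuous with compact support, `‖e‖ = 1`).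
[folklore] -/
theorem integrableOn_dens_translate {Ω : Opens (EuclideanSpace ℝ (Fin 3))}
    {U : EuclideanSpace ℝ (Fin 3) → F} {G : EuclideanSpace ℝ (Fin 3) → EuclideanSpace ℝ (Fin 3) →L[ℝ] F}
    (hU : HasWeakFDerivOn Ω volume U G)
    (hGi : IntegrableOn (fun x => ∑ i : Fin 3, ‖G x (EuclideanSpace.single i (1:ℝ))‖ ^ 2) (Ω : Set _) volume)
    {e : F} (he : ‖e‖ = 1) {ζ : EuclideanSpace ℝ (Fin 3) → ℝ} (hζ : ContDiff ℝ ∞ ζ) (hζc : HasCompactSupport ζ)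
    {t : ℝ} (ht : |t| ≤ 1) :
    IntegrableOn (fun x => ∑ i : Fin 3, ‖(G x + (t • fderiv ℝ ζ x).smulRight e) (EuclideanSpace.single i (1:ℝ))‖ ^ 2)
      (Ω : Set _) volume := by
  have hζ'c : Continuous (fderiv ℝ ζ) := hζ.continuous_fderiv (by simp)
  have hY := hasWeakFDerivOn_translate hU e hζ t
  have ha_cont : ∀ i : Fin 3, Continuous fun x => fderiv ℝ ζ x (EuclideanSpace.single i (1:ℝ)) :=
    fun i => hζ'c.clm_apply continuous_const
  have ha_cs : ∀ i : Fin 3, HasCompactSupport fun x => fderiv ℝ ζ x (EuclideanSpace.single i (1:ℝ)) :=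
    fun i => hζc.fderiv_apply (𝕜 := ℝ) (EuclideanSpace.single i (1:ℝ))
  have hdom : IntegrableOn (fun x => 2 * (∑ i : Fin 3, ‖G x (EuclideanSpace.single i (1:ℝ))‖ ^ 2) +
      2 * ∑ i : Fin 3, fderiv ℝ ζ x (EuclideanSpace.single i (1:ℝ)) * fderiv ℝ ζ x (EuclideanSpace.single i (1:ℝ)))
      (Ω : Set _) volume := by
    refine (hGi.const_mul 2).add (Integrable.const_mul (integrable_finsetSum _ fun i _ => ?_) 2)
    exact (((ha_cont i).mul (ha_cont i)).integrable_of_hasCompactSupport (ha_cs i).mul_left).integrableOn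
  have hmeas : AEStronglyMeasurable (fun x => ∑ i : Fin 3,
      ‖(G x + (t • fderiv ℝ ζ x).smulRight e) (EuclideanSpace.single i (1:ℝ))‖ ^ 2) (volume.restrict (Ω : Set _)) := by
    have hGYm : AEStronglyMeasurable (fun x => G x + (t • fderiv ℝ ζ x).smulRight e) (volume.restrict (Ω : Set _)) :=
      hY.locallyIntegrableOn_deriv.aestronglyMeasurable
    exact Finset.aestronglyMeasurable_fun_sum _ fun i _ =>
      ((hGYm.apply_continuousLinearMap (EuclideanSpace.single i (1:ℝ))).norm.pow 2)
  refine Integrable.mono' hdom hmeas (ae_of_all _ fun x => ?_)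
  rw [Real.norm_of_nonneg (Finset.sum_nonneg fun i _ => by positivity), Finset.mul_sum, Finset.mul_sum,
    ← Finset.sum_add_distrib]
  refine Finset.sum_le_sum fun i _ => ?_
  have h1 : ‖(G x + (t • fderiv ℝ ζ x).smulRight e) (EuclideanSpace.single i (1:ℝ))‖ ≤
      ‖G x (EuclideanSpace.single i (1:ℝ))‖ + |fderiv ℝ ζ x (EuclideanSpace.single i (1:ℝ))| := by
    rw [add_apply, ContinuousLinearMap.smulRight_apply, smul_apply, smul_eq_mul]
    refine (norm_add_le _ _).trans ?_
    rw [norm_smul, he, mul_one, Real.norm_eq_abs, abs_mul]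
    have : |t| * |fderiv ℝ ζ x (EuclideanSpace.single i (1:ℝ))| ≤ 1 * |fderiv ℝ ζ x (EuclideanSpace.single i (1:ℝ))| :=
      mul_le_mul_of_nonneg_right ht (abs_nonneg _)
    linarith
  have h0 := norm_nonneg ((G x + (t • fderiv ℝ ζ x).smulRight e) (EuclideanSpace.single i (1:ℝ)))
  nlinarith [sq_nonneg (‖G x (EuclideanSpace.single i (1:ℝ))‖ - |fderiv ℝ ζ x (EuclideanSpace.single i (1:ℝ))|),
    sq_abs (fderiv ℝ ζ x (EuclideanSpace.single i (1:ℝ)))]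

omit [CompleteSpace F] in
/-- ★ **THE NORMALISED DENSITY AT A POINT** (no measure theory): at a point where `‖u‖ = 1`, `⟪u, gᵢ⟫ = 0` for all `i`, `‖e‖ = 1`
and `|t·z| ≤ ¼`, with `Y := u + (t z)•e` and `hᵢ := gᵢ + (t aᵢ)•e`:
`Σᵢ ‖DN(Y) hᵢ‖² = Σᵢ (D·Hᵢ − Kᵢ²)∕D²` in the letters of ✓`…MinimiserStabilityLetters`. [cite: SchoenUhlenbeck1984, §1] -/
theorem dens_normalised_pointwise {u e : F} (hu : ‖u‖ = 1) (he : ‖e‖ = 1) (g : Fin 3 → F) (hκ : ∀ i, ⟪u, g i⟫ = 0)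
    (a : Fin 3 → ℝ) {t z : ℝ} (htz : |t * z| ≤ 1 / 4) :
    ∑ i : Fin 3, ‖fderiv ℝ (fun y : F => Real.smoothTransition (‖y‖ ^ 2 / (1 / 4) ^ 2 - 1) • (‖y‖⁻¹ • y)) (u + (t * z) • e)
        (g i + (t * a i) • e)‖ ^ 2 =
      ∑ i : Fin 3, ((1 + 2 * t * z * ⟪u, e⟫ + t ^ 2 * z ^ 2) * (‖g i‖ ^ 2 + 2 * t * a i * ⟪g i, e⟫ + t ^ 2 * a i ^ 2) -
          (t * (a i * ⟪u, e⟫ + z * ⟪g i, e⟫) + t ^ 2 * z * a i) ^ 2) / (1 + 2 * t * z * ⟪u, e⟫ + t ^ 2 * z ^ 2) ^ 2 := by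
  -- `‖Y‖ ≥ 3/4`
  have hYn : 3 / 4 ≤ ‖u + (t * z) • e‖ := by
    have h1 : ‖(t * z) • e‖ ≤ 1 / 4 := by rw [norm_smul, he, mul_one, Real.norm_eq_abs]; exact htz
    have h2 := norm_sub_norm_le u (-((t * z) • e))
    rw [sub_neg_eq_add, norm_neg, hu] at h2
    linarith
  have hY8 : 1 / 8 < ‖u + (t * z) • e‖ ^ 2 := by nlinarith
  have hee : ⟪e, e⟫ = 1 := by rw [real_inner_self_eq_norm_sq, he, one_pow]
  have huu : ⟪u, u⟫ = 1 := by rw [real_inner_self_eq_norm_sq, hu, one_pow]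
  have hY2 : ‖u + (t * z) • e‖ ^ 2 = 1 + 2 * t * z * ⟪u, e⟫ + t ^ 2 * z ^ 2 := by
    rw [← real_inner_self_eq_norm_sq]
    simp only [inner_add_left, inner_add_right, real_inner_smul_left, real_inner_smul_right, huu, hee, real_inner_comm u e]
    ring
  have hY4 : ‖u + (t * z) • e‖ ^ 4 = (1 + 2 * t * z * ⟪u, e⟫ + t ^ 2 * z ^ 2) ^ 2 := by
    rw [← hY2]; ring
  refine Finset.sum_congr rfl fun i _ => ?_
  rw [norm_fderiv_smoothNormalize_apply_sq hY8]
  have hH : ‖g i + (t * a i) • e‖ ^ 2 = ‖g i‖ ^ 2 + 2 * t * a i * ⟪g i, e⟫ + t ^ 2 * a i ^ 2 := by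
    rw [← real_inner_self_eq_norm_sq, ← real_inner_self_eq_norm_sq (g i)]
    simp only [inner_add_left, inner_add_right, real_inner_smul_left, real_inner_smul_right, hee, real_inner_comm (g i) e]
    ring
  have hK : ⟪u + (t * z) • e, g i + (t * a i) • e⟫ = t * (a i * ⟪u, e⟫ + z * ⟪g i, e⟫) + t ^ 2 * z * a i := by
    simp only [inner_add_left, inner_add_right, real_inner_smul_left, real_inner_smul_right, hee, hκ i, real_inner_comm (g i) e]
    ring
  rw [hY4, hY2, hH, hK]

omit [CompleteSpace F] in
/-- **Composition with a bounded operator field keeps the density integrable**: if `‖L x‖ ≤ C` for all `x`, `x ↦ L x ∘ A x` is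
a.e.-strongly measurable on `S` and `Σᵢ‖A x eᵢ‖²` is integrable on `S`, then so is `Σᵢ‖(L x ∘ A x) eᵢ‖²` (`≤ C²·Σᵢ‖A x eᵢ‖²`).
[folklore] -/
theorem integrableOn_dens_comp {S : Set (EuclideanSpace ℝ (Fin 3))}
    {A : EuclideanSpace ℝ (Fin 3) → EuclideanSpace ℝ (Fin 3) →L[ℝ] F} {L : EuclideanSpace ℝ (Fin 3) → F →L[ℝ] F} {C : ℝ}
    (hL : ∀ x, ‖L x‖ ≤ C)
    (hm : AEStronglyMeasurable (fun x => (L x).comp (A x)) (volume.restrict S))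
    (hA : IntegrableOn (fun x => ∑ i : Fin 3, ‖A x (EuclideanSpace.single i (1:ℝ))‖ ^ 2) S volume) :
    IntegrableOn (fun x => ∑ i : Fin 3, ‖((L x).comp (A x)) (EuclideanSpace.single i (1:ℝ))‖ ^ 2) S volume := by
  have hmeas : AEStronglyMeasurable (fun x => ∑ i : Fin 3, ‖((L x).comp (A x)) (EuclideanSpace.single i (1:ℝ))‖ ^ 2)
      (volume.restrict S) :=
    Finset.aestronglyMeasurable_fun_sum _ fun i _ => ((hm.apply_continuousLinearMap (EuclideanSpace.single i (1:ℝ))).norm.pow 2)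
  refine Integrable.mono' (hA.const_mul (C ^ 2)) hmeas (ae_of_all _ fun x => ?_)
  rw [Real.norm_of_nonneg (Finset.sum_nonneg fun i _ => by positivity), Finset.mul_sum]
  refine Finset.sum_le_sum fun i _ => ?_
  rw [ContinuousLinearMap.comp_apply]
  have h0 := norm_nonneg ((L x) (A x (EuclideanSpace.single i (1:ℝ))))
  have h1 : ‖(L x) (A x (EuclideanSpace.single i (1:ℝ)))‖ ≤ C * ‖A x (EuclideanSpace.single i (1:ℝ))‖ :=
    ((L x).le_opNorm _).trans (mul_le_mul_of_nonneg_right (hL x) (norm_nonneg _))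
  calc ‖(L x) (A x (EuclideanSpace.single i (1:ℝ)))‖ ^ 2 ≤ (C * ‖A x (EuclideanSpace.single i (1:ℝ))‖) ^ 2 :=
        pow_le_pow_left₀ h0 h1 2
    _ = C ^ 2 * ‖A x (EuclideanSpace.single i (1:ℝ))‖ ^ 2 := by ring

/-- ★★ **THE NORMALISED COMPETITOR.**  For a unit vector `e`, `ζ ∈ C^∞_c` with `|ζ| ≤ 1`, `‖∇ζ‖ ≤ 1`, and `|t| ≤ ¼`: there are
`W, GW` with `HasWeakFDerivOn Ω volume W GW`, `W` unit on `Ω`, `dens GW` integrable on `Ω`, `W x = U x` whenever `ζ x = 0` (every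
`x`), and for a.e. `x ∈ Ω` the density is the letters' rational function:
`Σᵢ ‖GW eᵢ‖² = Σᵢ (D·Hᵢ − Kᵢ²)∕D²` with `D = 1 + 2tζb + t²ζ²`, `Hᵢ = gᵢ + 2t aᵢ cᵢ + t²aᵢ²`, `Kᵢ = t(aᵢb + ζcᵢ) + t²ζaᵢ`
(`b = ⟪U,e⟫`, `cᵢ = ⟪G eᵢ, e⟫`, `gᵢ = ‖G eᵢ‖²`, `aᵢ = ∂ᵢζ`). [cite: SchoenUhlenbeck1984, §1] -/
theorem exists_normalised_competitor {Ω : Opens (EuclideanSpace ℝ (Fin 3))}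
    {U : EuclideanSpace ℝ (Fin 3) → F} {G : EuclideanSpace ℝ (Fin 3) → EuclideanSpace ℝ (Fin 3) →L[ℝ] F}
    (hU : HasWeakFDerivOn Ω volume U G) (hU1 : ∀ x ∈ (Ω : Set (EuclideanSpace ℝ (Fin 3))), ‖U x‖ = 1)
    (hGi : IntegrableOn (fun x => ∑ i : Fin 3, ‖G x (EuclideanSpace.single i (1:ℝ))‖ ^ 2) (Ω : Set _) volume)
    {e : F} (he : ‖e‖ = 1)
    {ζ : EuclideanSpace ℝ (Fin 3) → ℝ} (hζ : ContDiff ℝ ∞ ζ) (hζc : HasCompactSupport ζ)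
    (hζ1 : ∀ x, |ζ x| ≤ 1) {t : ℝ} (ht : |t| ≤ 1 / 4) :
    ∃ (W : EuclideanSpace ℝ (Fin 3) → F) (GW : EuclideanSpace ℝ (Fin 3) → EuclideanSpace ℝ (Fin 3) →L[ℝ] F),
      HasWeakFDerivOn Ω volume W GW ∧ (∀ x ∈ (Ω : Set (EuclideanSpace ℝ (Fin 3))), ‖W x‖ = 1) ∧
      IntegrableOn (fun x => ∑ i : Fin 3, ‖GW x (EuclideanSpace.single i (1:ℝ))‖ ^ 2) (Ω : Set _) volume ∧
      (∀ x, ζ x = 0 → W x = U x) ∧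
      ∀ᵐ x ∂(volume.restrict (Ω : Set (EuclideanSpace ℝ (Fin 3)))), ∑ i : Fin 3, ‖GW x (EuclideanSpace.single i (1:ℝ))‖ ^ 2 =
        ∑ i : Fin 3, ((1 + 2 * t * ζ x * ⟪U x, e⟫ + t ^ 2 * ζ x ^ 2) *
            (‖G x (EuclideanSpace.single i (1:ℝ))‖ ^ 2 +
              2 * t * fderiv ℝ ζ x (EuclideanSpace.single i (1:ℝ)) * ⟪G x (EuclideanSpace.single i (1:ℝ)), e⟫ +
              t ^ 2 * fderiv ℝ ζ x (EuclideanSpace.single i (1:ℝ)) ^ 2) -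
            (t * (fderiv ℝ ζ x (EuclideanSpace.single i (1:ℝ)) * ⟪U x, e⟫ + ζ x * ⟪G x (EuclideanSpace.single i (1:ℝ)), e⟫) +
              t ^ 2 * ζ x * fderiv ℝ ζ x (EuclideanSpace.single i (1:ℝ))) ^ 2) /
          (1 + 2 * t * ζ x * ⟪U x, e⟫ + t ^ 2 * ζ x ^ 2) ^ 2 := by
  have hY := hasWeakFDerivOn_translate hU e hζ t
  -- the smooth normalisation and the chain rule
  obtain ⟨C, hC⟩ := exists_norm_fderiv_smoothNormalize_le (V := F)
  have hW := hasWeakFDerivOn_comp_of_fderiv_bounded (μ := volume) hY (contDiff_smoothNormalize (V := F)) hC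
  -- `‖Y‖ ≥ 3/4` on `Ω`
  have htζ : ∀ x, |t * ζ x| ≤ 1 / 4 := fun x => by
    rw [abs_mul]
    calc |t| * |ζ x| ≤ 1 / 4 * 1 := mul_le_mul ht (hζ1 x) (abs_nonneg _) (by norm_num)
      _ = 1 / 4 := by norm_num
  have hYn : ∀ x ∈ (Ω : Set (EuclideanSpace ℝ (Fin 3))), 3 / 4 ≤ ‖U x + (t * ζ x) • e‖ := by
    intro x hx
    have h1 : ‖(t * ζ x) • e‖ ≤ 1 / 4 := by rw [norm_smul, he, mul_one, Real.norm_eq_abs]; exact htζ x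
    have h2 := norm_sub_norm_le (U x) (-((t * ζ x) • e))
    rw [sub_neg_eq_add, norm_neg, hU1 x hx] at h2
    linarith
  have hY8 : ∀ x ∈ (Ω : Set (EuclideanSpace ℝ (Fin 3))), 1 / 8 < ‖U x + (t * ζ x) • e‖ ^ 2 := by
    intro x hx
    have := hYn x hx
    nlinarith
  -- the competitor, continued by `U` off `Ω` (opaque names with defining equations; `Set.indicator`, no `Decidable`)
  obtain ⟨W, hWdef⟩ : ∃ W : EuclideanSpace ℝ (Fin 3) → F, ∀ x, W x =
      (Ω : Set (EuclideanSpace ℝ (Fin 3))).indicator (fun x =>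
        Real.smoothTransition (‖U x + (t * ζ x) • e‖ ^ 2 / (1 / 4) ^ 2 - 1) • (‖U x + (t * ζ x) • e‖⁻¹ • (U x + (t * ζ x) • e))
          - U x) x + U x := ⟨_, fun x => rfl⟩
  obtain ⟨GW, hGWdef⟩ : ∃ GW : EuclideanSpace ℝ (Fin 3) → EuclideanSpace ℝ (Fin 3) →L[ℝ] F, ∀ x, GW x =
      (fderiv ℝ (fun y : F => Real.smoothTransition (‖y‖ ^ 2 / (1 / 4) ^ 2 - 1) • (‖y‖⁻¹ • y)) (U x + (t * ζ x) • e)).comp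
        (G x + (t • fderiv ℝ ζ x).smulRight e) := ⟨_, fun x => rfl⟩
  have hWΩ : ∀ x ∈ (Ω : Set (EuclideanSpace ℝ (Fin 3))), W x =
      Real.smoothTransition (‖U x + (t * ζ x) • e‖ ^ 2 / (1 / 4) ^ 2 - 1) • (‖U x + (t * ζ x) • e‖⁻¹ • (U x + (t * ζ x) • e)) :=
    fun x hx => by rw [hWdef x, Set.indicator_of_mem hx, sub_add_cancel]
  have hW' : HasWeakFDerivOn Ω volume W GW :=
    Literature.Analysis.FunctionSpaces.SobolevApprox.hasWeakFDerivOn_congr hW (fun x hx => hWΩ x hx) (fun x _ => hGWdef x)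
  -- unit on `Ω`
  have hW1 : ∀ x ∈ (Ω : Set (EuclideanSpace ℝ (Fin 3))), ‖W x‖ = 1 := by
    intro x hx
    rw [hWΩ x hx]
    exact norm_smoothNormalize (hY8 x hx).le
  -- `W = U` where `ζ = 0`
  have hWU : ∀ x, ζ x = 0 → W x = U x := by
    intro x hx
    by_cases hxΩ : x ∈ (Ω : Set (EuclideanSpace ℝ (Fin 3)))
    · rw [hWΩ x hxΩ, hx, mul_zero, zero_smul, add_zero,
        smoothNormalize_eq (by rw [hU1 x hxΩ]; norm_num), hU1 x hxΩ, inv_one, one_smul]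
    · rw [hWdef x, Set.indicator_of_notMem hxΩ, zero_add]
  -- integrability of the density on `Ω`
  have hGYi := integrableOn_dens_translate hU hGi he hζ hζc (ht.trans (by norm_num))
  have hWi : IntegrableOn (fun x => ∑ i : Fin 3, ‖GW x (EuclideanSpace.single i (1:ℝ))‖ ^ 2) (Ω : Set _) volume := by
    have hfun : (fun x => ∑ i : Fin 3, ‖GW x (EuclideanSpace.single i (1:ℝ))‖ ^ 2) = fun x => ∑ i : Fin 3,
        ‖((fderiv ℝ (fun y : F => Real.smoothTransition (‖y‖ ^ 2 / (1 / 4) ^ 2 - 1) • (‖y‖⁻¹ • y)) (U x + (t * ζ x) • e)).comp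
          (G x + (t • fderiv ℝ ζ x).smulRight e)) (EuclideanSpace.single i (1:ℝ))‖ ^ 2 := by
      funext x; simp only [hGWdef x]
    rw [hfun]
    exact integrableOn_dens_comp (fun x => hC _) hW.locallyIntegrableOn_deriv.aestronglyMeasurable hGYi
  refine ⟨W, GW, hW', hW1, hWi, hWU, ?_⟩
  -- the a.e. density identity
  have htζ' : ∀ x, |t * ζ x| ≤ 1 / 4 := htζ
  filter_upwards [inner_weakGrad_eq_zero_ae hU hU1, ae_restrict_mem Ω.isOpen.measurableSet] with x hκ hxΩ
  have hGW : ∀ i : Fin 3, GW x (EuclideanSpace.single i (1:ℝ)) =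
      fderiv ℝ (fun y : F => Real.smoothTransition (‖y‖ ^ 2 / (1 / 4) ^ 2 - 1) • (‖y‖⁻¹ • y)) (U x + (t * ζ x) • e)
        (G x (EuclideanSpace.single i (1:ℝ)) + (t * fderiv ℝ ζ x (EuclideanSpace.single i (1:ℝ))) • e) := by
    intro i
    rw [hGWdef x, ContinuousLinearMap.comp_apply, add_apply, ContinuousLinearMap.smulRight_apply, smul_apply, smul_eq_mul]
  rw [Finset.sum_congr rfl fun i _ => by rw [hGW i]]
  exact dens_normalised_pointwise (hU1 x hxΩ) he (fun i => G x (EuclideanSpace.single i (1:ℝ))) (fun i => hκ _)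
    (fun i => fderiv ℝ ζ x (EuclideanSpace.single i (1:ℝ))) (htζ' x)

end Summit.QuantumFields.YangMills.Theorems.PoincareLipschitzMinimiserSecondVariation

end
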